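import Literature.AlgebraicGeometry.RelativeSpec.FiniteGroupQuotientGluing
import HarnessLib

/-!
# Finite subsets in affine opens: quotients by finite groups, fibre products

A scheme has the **(AF) property** ("quasi-projective in the weak sense") if every finite subset
lies in an affine open. This is the hypothesis under which quotients by finite groups exist
(Mumford, *Abelian Varieties*, §7, Thm. p. 66; SGA 1, Exp. V, Prop. 1.8) and it is inherited by
the constructions of `Literature.AlgebraicGeometry.RelativeSpec`:

* `ActionOver.exists_stableAffineOpen_forall_mem` — a finite set all of whose translates lie in
  an affine open `U` lies in a `G`-stable affine open inside `U` (the intersection of the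
  translates of `U`; Mumford's reduction in the proof of §7, Thm. p. 66);
* `ActionOver.exists_isAffineOpen_finset_subset_glued` — **(AF) passes to `X/G`**: a finite
  subset of the glued quotient lifts to finitely many points of `X`, whose orbits lie in one
  stable affine `O`, and the chart `O/G ↪ X/G` is an affine open containing the subset;
* `exists_isAffineOpen_finset_subset_pullback` — **(AF) passes to fibre products over an affine
  base**: project to the factors, take affine opens `U, V` there, and use the affine open
  `U ×_S V ↪ X ×_S Y`;
* `exists_isAffineOpen_finset_subset_of_isAffineHom` — (AF) lifts along affine morphisms.

## References

* D. Mumford, *Abelian Varieties* (1970), §7, Thm. p. 66 (proof). [MumfordAV1970]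
* A. Grothendieck, *SGA 1*, Exp. V, Prop. 1.8. [SGA1]
-/

noncomputable section

universe u

open CategoryTheory Limits AlgebraicGeometry

namespace Literature.AlgebraicGeometry.RelativeSpec

namespace ActionOver

set_option backward.isDefEq.respectTransparency false

variable {X Y : Scheme.{u}} {r : X ⟶ Y} {G : Type*} [Group G] [Finite G] (ρ : ActionOver r G)

/-- **A finite set of orbits in an affine open lies in a stable affine open inside it**: if `X`
is separated, `Y` affine and all translates of the points of `S` lie in the affine open `U`, then
`⋂_g g⁻¹U` is a `G`-stable affine open containing `S` and contained in `U` (Mumford, AV §7,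
proof of the Theorem on p. 66). [cite: MumfordAV1970, §7 Thm. p. 66 (proof)] -/
theorem exists_stableAffineOpen_forall_mem [X.IsSeparated] [IsAffine Y] (S : Set X) (U : X.Opens)
    (hU : IsAffineOpen U) (hS : ∀ x ∈ S, ∀ g : G, (ρ.aut g).hom x ∈ U) :
    ∃ O : ρ.StableAffineOpens, S ⊆ O.1 ∧ O.1 ≤ U := by
  classical
  haveI : Fintype G := Fintype.ofFinite G
  let V : G → X.Opens := fun g ↦ (ρ.aut g).hom ⁻¹ᵁ U
  let O : X.Opens := Finset.univ.inf V
  have hmem : ∀ y : X, y ∈ O ↔ ∀ g : G, (ρ.aut g).hom y ∈ U := fun y ↦ by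
    rw [← SetLike.mem_coe, TopologicalSpace.Opens.coe_finset_inf, Finset.inf_eq_iInf]
    simp only [Function.comp_apply, Set.iInf_eq_iInter, Set.mem_iInter, SetLike.mem_coe,
      Finset.mem_univ, forall_const]
    rfl
  have hcomp : ∀ g h : G, (ρ.aut g).hom ≫ (ρ.aut h).hom = (ρ.aut (h * g)).hom := fun g h ↦ by
    rw [map_mul, Aut.Aut_mul_def]; rfl
  have hO : ∀ g : G, (ρ.aut g).hom ⁻¹ᵁ O = O := by
    intro g
    ext y
    change (ρ.aut g).hom y ∈ O ↔ y ∈ O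
    rw [hmem, hmem]
    constructor
    · intro H h
      have := H (h * g⁻¹)
      rwa [← Scheme.Hom.comp_apply, hcomp, inv_mul_cancel_right] at this
    · intro H h
      rw [← Scheme.Hom.comp_apply, hcomp]
      exact H (h * g)
  have hOaff : IsAffineOpen O := by
    have : ∀ (s : Finset G), s.Nonempty → IsAffineOpen (s.inf V) := by
      intro s hs
      induction hs using Finset.Nonempty.cons_induction with
      | singleton a => simpa using hU.preimage_of_isIso (ρ.aut a).hom
      | cons a s ha hs ih => rw [Finset.cons_eq_insert, Finset.inf_insert]
                             exact (hU.preimage_of_isIso (ρ.aut a).hom).inf ih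
    exact this _ ⟨1, Finset.mem_univ _⟩
  haveI : IsAffine (O : Scheme.{u}) := hOaff
  refine ⟨⟨O, hO, inferInstance⟩, fun x hx ↦ (hmem x).mpr (hS x hx), ?_⟩
  intro y hy
  have := (hmem y).mp hy 1
  rwa [map_one] at this

variable [Y.IsSeparated] [IsSeparated r]

omit [Y.IsSeparated] in
/-- The chart `O/G` of the glued quotient is affine when the base is affine. [folklore] -/
theorem isAffine_pieceQuot [IsAffine Y] (O : ρ.StableAffineOpens) : IsAffine (ρ.pieceQuot O) :=
  isAffine_of_isAffineHom (ρ.restrict O.1 O.2.1).quotientToBase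

/-- **(AF) passes to the quotient `X/G`.** If `X` is separated over the affine `Y`, every finite
subset of `X` lies in an affine open, and `X` is covered by stable opens affine over `Y` (so that
the glued quotient `X/G` exists), then every finite subset of `X/G` lies in an affine open: lift
the points, put all their translates in one affine `U`, pass to the stable affine
`O = ⋂ g⁻¹U`, and use the affine chart `O/G ↪ X/G`. [cite: MumfordAV1970, §7 Thm. p. 66] -/
theorem exists_isAffineOpen_finset_subset_glued [X.IsSeparated] [IsAffine Y]
    (hfin : ∀ S : Finset X, ∃ U : X.Opens, IsAffineOpen U ∧ (↑S : Set X) ⊆ U)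
    (hcov : ∀ x : X, ∃ O : ρ.StableAffineOpens, x ∈ O.1) (T : Finset ρ.glued) :
    ∃ W : ρ.glued.Opens, IsAffineOpen W ∧ (↑T : Set ρ.glued) ⊆ W := by
  classical
  haveI : Fintype G := Fintype.ofFinite G
  choose xs hxs using ρ.gluedMk_surjective hcov
  obtain ⟨U, hU, hSU⟩ := hfin ((T ×ˢ (Finset.univ : Finset G)).image
    fun tg ↦ (ρ.aut tg.2).hom (xs tg.1))
  obtain ⟨O, hO, -⟩ := ρ.exists_stableAffineOpen_forall_mem {x | ∃ t ∈ T, xs t = x} U hU (by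
    rintro _ ⟨t, ht, rfl⟩ g
    apply hSU
    simp only [Finset.coe_image, Finset.coe_product, Finset.coe_univ, Set.mem_image,
      Set.mem_prod, Set.mem_univ, and_true, Finset.mem_coe, Prod.exists]
    exact ⟨t, g, ht, rfl⟩)
  haveI := ρ.isAffine_pieceQuot O
  refine ⟨(ρ.gluedι O).opensRange, isAffineOpen_opensRange (ρ.gluedι O), fun t ht ↦ ?_⟩
  have hx : xs t ∈ O.1 := hO ⟨t, ht, rfl⟩
  change t ∈ Set.range (ρ.gluedι O)
  rw [← hxs t]
  exact ⟨ρ.pieceMk O ⟨xs t, hx⟩, (ρ.gluedMk_apply hcov O ⟨xs t, hx⟩).symm⟩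

end ActionOver

/-! ### Fibre products and affine morphisms -/

/-- **(AF) passes to fibre products over an affine base**: if every finite subset of `X` and of
`Y` lies in an affine open then so does every finite subset `T` of `X ×_S Y`, `S` affine —
namely in `U ×_S V` for affine opens `U ⊇ pr₁(T)`, `V ⊇ pr₂(T)`. [folklore] -/
theorem exists_isAffineOpen_finset_subset_pullback {X Y S : Scheme.{u}} (f : X ⟶ S) (g : Y ⟶ S)
    [IsAffine S] (hX : ∀ T : Finset X, ∃ U : X.Opens, IsAffineOpen U ∧ (↑T : Set X) ⊆ U)
    (hY : ∀ T : Finset Y, ∃ U : Y.Opens, IsAffineOpen U ∧ (↑T : Set Y) ⊆ U)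
    (T : Finset ↑(pullback f g)) :
    ∃ W : (pullback f g).Opens, IsAffineOpen W ∧ (↑T : Set ↑(pullback f g)) ⊆ W := by
  classical
  obtain ⟨U, hU, hTU⟩ := hX (T.image (pullback.fst f g))
  obtain ⟨V, hV, hTV⟩ := hY (T.image (pullback.snd f g))
  let ι := pullback.map (U.ι ≫ f) (V.ι ≫ g) f g U.ι V.ι (𝟙 S) (by simp) (by simp)
  haveI : IsAffine (U : Scheme.{u}) := hU
  haveI : IsAffine (V : Scheme.{u}) := hV
  refine ⟨ι.opensRange, isAffineOpen_opensRange ι, fun t ht ↦ ?_⟩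
  change t ∈ Set.range ι
  rw [Scheme.Pullback.range_map]
  refine ⟨?_, ?_⟩
  · rw [Set.mem_preimage, Scheme.Opens.range_ι]
    exact hTU (by simpa using Finset.mem_image_of_mem (pullback.fst f g) ht)
  · rw [Set.mem_preimage, Scheme.Opens.range_ι]
    exact hTV (by simpa using Finset.mem_image_of_mem (pullback.snd f g) ht)

/-- **(AF) lifts along affine morphisms**: if every finite subset of `Y` lies in an affine open
and `f : X ⟶ Y` is affine, then every finite subset `T` of `X` lies in the affine open
`f⁻¹W`, `W ⊇ f(T)` affine. [folklore] -/
theorem exists_isAffineOpen_finset_subset_of_isAffineHom {X Y : Scheme.{u}} (f : X ⟶ Y)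
    [IsAffineHom f] (hY : ∀ T : Finset Y, ∃ U : Y.Opens, IsAffineOpen U ∧ (↑T : Set Y) ⊆ U)
    (T : Finset X) : ∃ W : X.Opens, IsAffineOpen W ∧ (↑T : Set X) ⊆ W := by
  classical
  obtain ⟨U, hU, hTU⟩ := hY (T.image f)
  exact ⟨f ⁻¹ᵁ U, hU.preimage f, fun t ht ↦ hTU (by simpa using Finset.mem_image_of_mem f ht)⟩

end Literature.AlgebraicGeometry.RelativeSpec

end
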